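import Mathlib
import Literature.NumberTheory.Sieve.SingularSeries
import Summits.Parity.GeneralizedHardyLittlewood.Theorems.LiouvilleShiftedTablesPairsFromMAvgCoprimeSums

/-!
# `EngineToGHL` (stmt-Parity-14995), line `tuple_ladder`, stub `stub_rungEuler`

Crux `Summit.Parity.GeneralizedHardyLittlewood.Theses.LiouvilleMAD.EngineToGHL`, line `tuple_ladder`,
stub `stub_rungEuler`: the SINGULAR-SERIES IDENTITY of one rung of the tuple ladder.  For the
sub-tuple `H'`, the adjoined shift `hs ∉ H'` and the sieve weight
`w(d) = 𝟙[∀ h ∈ H', (d - hs % d + h, d) = 1]/#{ρ < d : ∀ h ∈ H', (ρ + h, d) = 1}`, whose arithmetic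
(`μ(d) d w(d) = (b ⋆ μ)(d)`, `b` multiplicative, `b(p^k) = β_p = 1 - p w(p)`, the value of `w(p)`,
`ν_{H'∪{hs}}(p) - ν_{H'}(p)`) is supplied as hypotheses (neighbour stub `stub_rungWeights`), we prove
`-∑_{d ≤ D} μ(d) w(d) log d → c := ∑_n b(n)/n` and `𝔖(H' ∪ {hs}) = 𝔖(H') · c`.  Abstract pieces:
`exists_sum_abs_div_sqrt_le_of_local` (`∑_{n ≤ N} |b(n)|/√n ≤ S` from `|β_p| ≤ T`, `|β_p| ≤ C/(p-1)`
for `p > M`; mirror of `PairsFromMAvg.exists_sum_abs_div_sqrt_le`), `hasProd_one_add_div`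
(`∏_p (1 + β_p/(p-1)) = ∑_n b(n)/n`, `EulerProduct.eulerProduct_hasProd`), `singularSeriesFactor_mul_eq`
(`σ_{H'}(p) (1 + β_p/(p-1)) = σ_{H'∪{hs}}(p)`), `tendsto_neg_sum_moebius_log_weight` (the limit, from
the tree's PNT-strength `PairsFromMAvg.abs_sum_convMoebius_log_div_add_le`).

[folklore]
-/

noncomputable section

open Finset Real ArithmeticFunction Filter
open scoped ArithmeticFunction.Moebius Topology

namespace Summit.Parity.GeneralizedHardyLittlewood.Theorems.EngineToGHL.TupleLadder

open Literature.NumberTheory.Sieve (tupleResidueCount singularSeriesFactor singularSeries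
  hasProd_singularSeriesFactor_holds tupleResidueCount_le_card tupleResidueCount_eq_card_of_lt_holds)
open Summit.Parity.GeneralizedHardyLittlewood.Theorems.PairsFromMAvg (sqrt_natCast_pow
  inv_pred_mul_sqrt_pred_le summable_norm_div_of_bound sum_range_succ_eq_sum_Icc
  abs_sum_convMoebius_log_div_add_le exists_abs_sum_moebius_div_le
  exists_abs_sum_moebius_log_div_add_one_le exists_abs_sum_moebius_div_le_div_log_sq
  exists_abs_sum_moebius_log_div_add_one_le_div_log_sq)

/-- **Uniform bound for `∑ |b(n)|/√n` from local data.** If `b` is multiplicative with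
`b(p^k) = β_p` for all `k ≥ 1`, `|β_p| ≤ T` at every prime and `|β_p| ≤ C/(p-1)` at the primes
`p > M`, then `∑_{n ≤ N} |b(n)|/√n ≤ S` for some `S` independent of `N` (Euler product over the
primes `≤ N`: `∏_{p ≤ N} ∑_e |b(p^e)| p^{-e/2} ≤ exp(3T(M+1) + 8C ∑ n^{-3/2})`). [folklore] -/
theorem exists_sum_abs_div_sqrt_le_of_local (b : ArithmeticFunction ℝ) (hb : b.IsMultiplicative)
    (β : ℕ → ℝ) (hbp : ∀ p k : ℕ, p.Prime → 1 ≤ k → b (p ^ k) = β p) {T C : ℝ} {M : ℕ}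
    (hT0 : 0 ≤ T) (hC0 : 0 ≤ C) (hT : ∀ p : ℕ, p.Prime → |β p| ≤ T)
    (hC : ∀ p : ℕ, p.Prime → M < p → |β p| ≤ C / ((p : ℝ) - 1)) :
    ∃ S : ℝ, ∀ N : ℕ, ∑ n ∈ Icc 1 N, |b n| / Real.sqrt n ≤ S := by
  set f : ℕ → ℝ := fun n => |b n| / Real.sqrt n with hf
  have hf1 : f 1 = 1 := by simp [hf, hb.map_one]
  have hfmul : ∀ {m n : ℕ}, Nat.Coprime m n → f (m * n) = f m * f n := by
    intro m n hmn
    simp only [hf]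
    rw [hb.map_mul_of_coprime hmn, abs_mul, Nat.cast_mul, Real.sqrt_mul (Nat.cast_nonneg _),
      mul_div_mul_comm]
  have hf0 : ∀ n, 0 ≤ f n := fun n => div_nonneg (abs_nonneg _) (Real.sqrt_nonneg _)
  -- the local data at a prime `p`
  have hfpe : ∀ {p : ℕ} (e : ℕ), p.Prime →
      f (p ^ (e + 1)) = |β p| * ((Real.sqrt p)⁻¹) ^ (e + 1) := by
    intro p e hp
    simp only [hf]
    rw [hbp p (e + 1) hp (by omega), sqrt_natCast_pow, inv_pow, div_eq_mul_inv]
  have hr : ∀ {p : ℕ}, p.Prime → (1.4 : ℝ) ≤ Real.sqrt p ∧ 0 ≤ (Real.sqrt p)⁻¹ ∧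
      (Real.sqrt p)⁻¹ ≤ 0.72 := by
    intro p hp
    have hp2 : (2 : ℝ) ≤ p := by exact_mod_cast hp.two_le
    have h14 : (1.4 : ℝ) ≤ Real.sqrt p := by
      refine le_trans ?_ (Real.sqrt_le_sqrt hp2)
      rw [Real.le_sqrt (by norm_num) (by norm_num)]; norm_num
    refine ⟨h14, inv_nonneg.mpr (Real.sqrt_nonneg _), ?_⟩
    rw [inv_le_comm₀ (by linarith) (by norm_num)]
    exact le_trans (by norm_num) h14
  have hfle : ∀ {p : ℕ} (e : ℕ), p.Prime → f (p ^ e) ≤ max 1 T * ((Real.sqrt p)⁻¹) ^ e := by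
    intro p e hp
    rcases e with _ | e
    · simp [hf1]
    · rw [hfpe e hp]
      exact mul_le_mul_of_nonneg_right ((hT p hp).trans (le_max_right _ _))
        (pow_nonneg (hr hp).2.1 _)
  have hfsum : ∀ {p : ℕ}, p.Prime → Summable (fun e : ℕ => f (p ^ e)) := by
    intro p hp
    refine Summable.of_nonneg_of_le (fun e => hf0 _) (fun e => hfle e hp)
      ((summable_geometric_of_lt_one (hr hp).2.1 (by linarith [(hr hp).2.2])).mul_left _)
  -- the local factor `T_p = ∑_e f(p^e) ≤ exp(t_p)` with `t_p ≤ 3T·1_{p ≤ M} + 8C/(p√p)`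
  have hTp : ∀ {p : ℕ}, p.Prime → ∑' e : ℕ, f (p ^ e) ≤
      Real.exp ((if p ≤ M then 3 * T else 0) + 8 * C / ((p : ℝ) * Real.sqrt p)) := by
    intro p hp
    have hp2 : (2 : ℝ) ≤ p := by exact_mod_cast hp.two_le
    obtain ⟨h14, hr0, hr1⟩ := hr hp
    set r : ℝ := (Real.sqrt p)⁻¹ with hrdef
    have hr1' : r < 1 := by linarith
    rw [(hfsum hp).tsum_eq_zero_add, pow_zero, hf1]
    have htail : ∑' e : ℕ, f (p ^ (e + 1)) = |β p| * r * (1 - r)⁻¹ := by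
      rw [show (fun e : ℕ => f (p ^ (e + 1))) = fun e : ℕ => |β p| * r * r ^ e from
        funext fun e => by rw [hfpe e hp, pow_succ]; ring]
      rw [tsum_mul_left, tsum_geometric_of_lt_one hr0 hr1']
    rw [htail]
    refine le_trans ?_ (Real.add_one_le_exp _)
    rw [add_comm]
    gcongr
    -- `|β| r/(1-r) ≤ 3T·1_{p ≤ M} + 8C/(p√p)`
    have hgeo : r * (1 - r)⁻¹ = 1 / (Real.sqrt p - 1) := by rw [hrdef]; field_simp
    have hg0 : 0 ≤ r * (1 - r)⁻¹ := mul_nonneg hr0 (inv_nonneg.mpr (by linarith))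
    have hg3 : r * (1 - r)⁻¹ ≤ 3 := by rw [mul_inv_le_iff₀ (by linarith)]; linarith
    have h8 : 0 ≤ 8 * C / ((p : ℝ) * Real.sqrt p) := by positivity
    by_cases hpM : p ≤ M
    · rw [if_pos hpM]
      have : |β p| * r * (1 - r)⁻¹ ≤ T * 3 := by
        rw [mul_assoc]; exact mul_le_mul (hT p hp) hg3 hg0 hT0
      linarith
    · rw [if_neg hpM, zero_add, mul_assoc, hgeo]
      have hs1 : 0 ≤ 1 / (Real.sqrt p - 1) := div_nonneg zero_le_one (by linarith)
      calc |β p| * (1 / (Real.sqrt p - 1))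
          ≤ C / ((p : ℝ) - 1) * (1 / (Real.sqrt p - 1)) :=
            mul_le_mul_of_nonneg_right (hC p hp (not_le.mp hpM)) hs1
        _ = C * (1 / (((p : ℝ) - 1) * (Real.sqrt p - 1))) := by
            rw [div_mul_div_comm, mul_one, ← mul_one_div]
        _ ≤ C * (8 / ((p : ℝ) * Real.sqrt p)) :=
            mul_le_mul_of_nonneg_left (inv_pred_mul_sqrt_pred_le hp2) hC0
        _ = 8 * C / ((p : ℝ) * Real.sqrt p) := by ring
  -- summing `t_p` over the primes `p ≤ N`
  have hZ : Summable (fun n : ℕ => 8 * C / ((n : ℝ) * Real.sqrt n)) := by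
    have := (Real.summable_one_div_nat_rpow.mpr (by norm_num : (1 : ℝ) < 3 / 2)).mul_left (8 * C)
    refine this.congr fun n => ?_
    rw [show (3 / 2 : ℝ) = 1 + 1 / 2 by norm_num, Real.rpow_add' (Nat.cast_nonneg n) (by norm_num),
      Real.rpow_one, ← Real.sqrt_eq_rpow]
    ring
  set Z : ℝ := ∑' n : ℕ, 8 * C / ((n : ℝ) * Real.sqrt n) with hZdef
  refine ⟨Real.exp (3 * T * (M + 1) + Z), fun N => ?_⟩
  set s : Finset ℕ := (Finset.range (N + 1)).filter Nat.Prime with hs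
  have hsp : ∀ p ∈ s, p.Prime := fun p hp => (Finset.mem_filter.mp hp).2
  have hfact : ∀ d ∈ Icc 1 N, d ∈ Nat.factoredNumbers s := by
    intro d hd
    obtain ⟨hd1, hdN⟩ := Finset.mem_Icc.mp hd
    rw [Nat.mem_factoredNumbers']
    intro p hp hpd
    rw [hs, Finset.mem_filter, Finset.mem_range]
    exact ⟨Nat.lt_succ_of_le ((Nat.le_of_dvd hd1 hpd).trans hdN), hp⟩
  have hle := Literature.NumberTheory.Sieve.BombieriSieve.sum_le_prod_tsum_of_factored
    (h := f) hf1 hfmul hf0 hfsum hsp hfact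
  refine hle.trans ?_
  calc ∏ p ∈ s, ∑' e : ℕ, f (p ^ e)
      ≤ ∏ p ∈ s, Real.exp ((if p ≤ M then 3 * T else 0) + 8 * C / ((p : ℝ) * Real.sqrt p)) :=
        Finset.prod_le_prod (fun p _ => tsum_nonneg fun e => hf0 _) fun p hp => hTp (hsp p hp)
    _ = Real.exp (∑ p ∈ s, ((if p ≤ M then 3 * T else 0) + 8 * C / ((p : ℝ) * Real.sqrt p))) :=
        (Real.exp_sum _ _).symm
    _ ≤ Real.exp (3 * T * (M + 1) + Z) := by
        refine Real.exp_le_exp.mpr ?_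
        rw [Finset.sum_add_distrib]
        refine add_le_add ?_ (Summable.sum_le_tsum s (fun n _ => by positivity) hZ)
        rw [← Finset.sum_filter, Finset.sum_const, nsmul_eq_mul]
        have hcard : ((s.filter (· ≤ M)).card : ℝ) ≤ M + 1 := by
          have h1 : s.filter (· ≤ M) ⊆ Finset.range (M + 1) := fun p hp =>
            Finset.mem_range.mpr (Nat.lt_succ_of_le (Finset.mem_filter.mp hp).2)
          exact_mod_cast (Finset.card_le_card h1).trans_eq (Finset.card_range _)
        calc ((s.filter (· ≤ M)).card : ℝ) * (3 * T) ≤ ((M : ℝ) + 1) * (3 * T) := by gcongr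
          _ = 3 * T * (M + 1) := by ring

/-- **Euler product of `∑_n b(n)/n`.** For a multiplicative `b` with `b(p^k) = β_p` (`k ≥ 1`) and
`∑ |b(n)|/n < ∞`, Mathlib's `EulerProduct.eulerProduct_hasProd` gives
`∏_p (1 + β_p/(p-1)) = ∑_n b(n)/n` as a `HasProd` over `Nat.Primes` (the local factor is the
geometric series `1 + β_p ∑_{e ≥ 1} p^{-e} = 1 + β_p/(p-1)`). [folklore] -/
theorem hasProd_one_add_div (b : ArithmeticFunction ℝ) (hb : b.IsMultiplicative) (β : ℕ → ℝ)
    (hbp : ∀ p k : ℕ, p.Prime → 1 ≤ k → b (p ^ k) = β p)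
    (hsum : Summable fun n : ℕ => ‖b n / n‖) :
    HasProd (fun p : Nat.Primes => 1 + β p / (((p : ℕ) : ℝ) - 1)) (∑' n : ℕ, b n / n) := by
  set f : ℕ → ℝ := fun n => b n / n with hf
  have hf1 : f 1 = 1 := by simp [hf, hb.map_one]
  have hfmul : ∀ {m n : ℕ}, Nat.Coprime m n → f (m * n) = f m * f n := by
    intro m n hmn
    simp only [hf]
    rw [hb.map_mul_of_coprime hmn, Nat.cast_mul, mul_div_mul_comm]
  have hf0 : f 0 = 0 := by simp [hf]
  have hE := EulerProduct.eulerProduct_hasProd hf1 hfmul hsum hf0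
  -- the local factors
  have hloc : ∀ p : Nat.Primes, ∑' e : ℕ, f (p ^ e) = 1 + β p / (((p : ℕ) : ℝ) - 1) := by
    intro p
    have hp := p.2
    have hp2 : (2 : ℝ) ≤ (p : ℕ) := by exact_mod_cast hp.two_le
    have hp0 : ((p : ℕ) : ℝ) ≠ 0 := by positivity
    set r : ℝ := ((p : ℕ) : ℝ)⁻¹ with hr
    have hr0 : 0 ≤ r := by positivity
    have hr1 : r < 1 := by rw [hr]; exact inv_lt_one_of_one_lt₀ (by linarith)
    have hfe : ∀ e : ℕ, f ((p : ℕ) ^ (e + 1)) = β p * r * r ^ e := by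
      intro e
      simp only [hf]
      rw [hbp p (e + 1) hp (by omega), Nat.cast_pow, hr, div_eq_mul_inv, ← inv_pow, pow_succ]
      ring
    have hsumf : Summable fun e : ℕ => f ((p : ℕ) ^ e) := by
      rw [← summable_nat_add_iff 1]
      simp only [hfe]
      exact (summable_geometric_of_lt_one hr0 hr1).mul_left _
    rw [hsumf.tsum_eq_zero_add, pow_zero, hf1]
    simp only [hfe]
    rw [tsum_mul_left, tsum_geometric_of_lt_one hr0 hr1, hr, mul_assoc,
      show ((p : ℕ) : ℝ)⁻¹ * (1 - ((p : ℕ) : ℝ)⁻¹)⁻¹ = 1 / (((p : ℕ) : ℝ) - 1) by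
        rw [← mul_inv, mul_sub, mul_one, mul_inv_cancel₀ hp0, one_div],
      ← div_eq_mul_one_div]
  have hfun : (fun p : Nat.Primes => 1 + β p / (((p : ℕ) : ℝ) - 1)) =
      fun p : Nat.Primes => ∑' e : ℕ, f (p ^ e) := funext fun p => (hloc p).symm
  rw [hfun]
  exact hE

/-- **The Hardy–Littlewood factor identity of the rung.** If `#B = #A + 1`,
`ν_B(p) = ν_A(p) + 𝟙[¬E]` and (when `¬E`) `ν_A(p) < p`, then with
`β_p = 1 - p · (if E then 0 else (p - ν_A(p))⁻¹)` one has
`σ_A(p) · (1 + β_p/(p-1)) = σ_B(p)`, `σ_H(p) = (1 - ν_H(p)/p)(1 - 1/p)^{-#H}` the factor of the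
tree's `singularSeries`. (Case `E`: both sides are `σ_A(p) · p/(p-1)`; case `¬E`:
`(1 - ν/p)(1 - ν/((p-ν)(p-1))) = (1 - (ν+1)/p) · p/(p-1)`.) [folklore] -/
theorem singularSeriesFactor_mul_eq {A B : Finset ℤ} (hcard : B.card = A.card + 1) {p : ℕ}
    (hp : p.Prime) (E : Prop) [Decidable E]
    (hν : (tupleResidueCount B p : ℝ) = tupleResidueCount A p + (if E then 0 else 1))
    (hlt : ¬ E → tupleResidueCount A p < p) :
    singularSeriesFactor A p *
        (1 + (1 - (p : ℝ) * (if E then 0 else ((p : ℝ) - tupleResidueCount A p)⁻¹)) /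
          ((p : ℝ) - 1)) =
      singularSeriesFactor B p := by
  have hp2 : (2 : ℝ) ≤ p := by exact_mod_cast hp.two_le
  have hp0 : (p : ℝ) ≠ 0 := by positivity
  have hp1 : (p : ℝ) - 1 ≠ 0 := ne_of_gt (by linarith)
  have e1 : (1 - 1 / (p : ℝ))⁻¹ = p / ((p : ℝ) - 1) := by field_simp
  unfold singularSeriesFactor
  rw [hcard, pow_succ]
  generalize (1 - 1 / (p : ℝ))⁻¹ ^ A.card = q
  rw [e1]
  by_cases hE : E
  · rw [if_pos hE, add_zero] at hν
    rw [if_pos hE, hν, mul_zero, sub_zero]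
    field_simp
    ring
  · rw [if_neg hE] at hν
    have h1 : (tupleResidueCount A p : ℝ) + 1 ≤ p := by exact_mod_cast hlt hE
    have hpn : (p : ℝ) - tupleResidueCount A p ≠ 0 := ne_of_gt (by linarith)
    rw [if_neg hE, hν]
    field_simp
    ring

/-- **The truncated Möbius sum of the rung converges to `∑_n b(n)/n`.** If
`G(d) = μ(d) · d · w(d)` (`d ≠ 0`), `b ⋆ μ = G` and `∑_{n ≤ N} |b(n)|/√n ≤ S` uniformly, then
`-∑_{d ≤ D} μ(d) log d · w(d) = -∑_{d ≤ D} (b⋆μ)(d) log d/d → ∑_n b(n)/n` as `D → ∞`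
(the tree's `abs_sum_convMoebius_log_div_add_le`: `|∑_{d≤D} (b⋆μ)(d) log d/d + ∑_{n≤D} b(n)/n| ≤
S(27(C_m+C₁)(log D)⁻² + 5(K+K₁)D^{-1/8}) → 0`, with the prime number theorem for `μ` PROVED in the
tree; mirror of `PairsFromMAvg.tendsto_sum_coprime_moebius_mul_log_div_totient`). [folklore] -/
theorem tendsto_neg_sum_moebius_log_weight (b G : ArithmeticFunction ℝ) (w : ℕ → ℝ)
    (hG : ∀ d : ℕ, d ≠ 0 → G d = (μ d : ℝ) * (d : ℝ) * w d)
    (hbG : b * (μ : ArithmeticFunction ℝ) = G)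
    {S : ℝ} (hS : ∀ N, ∑ n ∈ Icc 1 N, |b n| / Real.sqrt n ≤ S) :
    Tendsto (fun D : ℕ => -∑ d ∈ Icc 1 D, (μ d : ℝ) * Real.log d * w d) atTop
      (𝓝 (∑' n : ℕ, b n / n)) := by
  obtain ⟨K, -, hK⟩ := exists_abs_sum_moebius_div_le
  obtain ⟨K₁, -, hK₁⟩ := exists_abs_sum_moebius_log_div_add_one_le
  obtain ⟨Cm, hCm0, hCm⟩ := exists_abs_sum_moebius_div_le_div_log_sq
  obtain ⟨C₁, hC₁0, hC₁⟩ := exists_abs_sum_moebius_log_div_add_one_le_div_log_sq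
  have hsum := summable_norm_div_of_bound b hS
  set a : ℕ → ℝ := fun D => ∑ d ∈ Icc 1 D, (μ d : ℝ) * Real.log d * w d with ha
  set s : ℕ → ℝ := fun D => ∑ n ∈ Icc 1 D, b n / n with hs
  -- `s D → ∑' n, b n / n`
  have hs_lim : Tendsto s atTop (𝓝 (∑' n : ℕ, b n / n)) := by
    have := (hsum.of_norm.tendsto_sum_tsum_nat).comp (tendsto_add_atTop_nat 1)
    refine this.congr fun D => ?_
    simp only [Function.comp_apply, hs]
    exact sum_range_succ_eq_sum_Icc b D
  -- `a D + s D → 0`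
  have hre : ∀ D : ℕ,
      ∑ d ∈ Icc 1 D, (b * (μ : ArithmeticFunction ℝ)) d * Real.log d / d = a D := by
    intro D
    rw [ha, hbG]
    refine Finset.sum_congr rfl fun d hd => ?_
    have hd1 : d ≠ 0 := by have := (Finset.mem_Icc.mp hd).1; omega
    have hd0 : (d : ℝ) ≠ 0 := by exact_mod_cast hd1
    rw [hG d hd1, div_eq_iff hd0]
    ring
  have hε : Tendsto (fun D : ℕ => S * (27 * (Cm + C₁) / Real.log D ^ 2) +
      S * (5 * (K + K₁) * (D : ℝ) ^ (-(1 / 8 : ℝ)))) atTop (𝓝 0) := by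
    have hlog : Tendsto (fun D : ℕ => Real.log D ^ 2) atTop atTop :=
      (tendsto_pow_atTop two_ne_zero).comp (Real.tendsto_log_atTop.comp tendsto_natCast_atTop_atTop)
    have h1 : Tendsto (fun D : ℕ => S * (27 * (Cm + C₁) / Real.log D ^ 2)) atTop (𝓝 0) := by
      have := (hlog.inv_tendsto_atTop).const_mul (S * (27 * (Cm + C₁)))
      rw [mul_zero] at this
      refine this.congr fun D => ?_
      simp only [Pi.inv_apply]
      ring
    have h2 : Tendsto (fun D : ℕ => S * (5 * (K + K₁) * (D : ℝ) ^ (-(1 / 8 : ℝ)))) atTop (𝓝 0) := by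
      have := ((tendsto_rpow_neg_atTop (by norm_num : (0 : ℝ) < 1 / 8)).comp
        tendsto_natCast_atTop_atTop).const_mul (S * (5 * (K + K₁)))
      rw [mul_zero] at this
      refine this.congr fun D => ?_
      simp only [Function.comp_apply]
      ring
    simpa using h1.add h2
  have has : Tendsto (fun D => a D + s D) atTop (𝓝 0) := by
    refine squeeze_zero_norm' ?_ hε
    filter_upwards [eventually_ge_atTop 64] with D hD
    rw [Real.norm_eq_abs]
    have := abs_sum_convMoebius_log_div_add_le b hS hK hK₁ hCm0 hCm hC₁0 hC₁ hD
    rwa [hre D] at this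
  have := hs_lim.sub has
  rw [sub_zero] at this
  refine this.congr fun D => ?_
  show s D - (a D + s D) = -a D
  ring

/-- **stub_rungEuler: the singular-series identity of the tuple-ladder rung.** With the arithmetic of
the sieve weight `w` supplied as hypotheses (`G(d) = μ(d) d w(d)`, `b ⋆ μ = G`, `b` multiplicative,
`b(p^k) = 1 - p w(p)`, `w(p) = 𝟙[¬E_p]/(p - ν_{H'}(p))`, `ν_{H'∪{hs}}(p) = ν_{H'}(p) + 𝟙[¬E_p]`,
`ν_{H'}(p) < p` if `¬E_p`, where `E_p : ∃ h ∈ H', p ∣ hs - h`): `-∑_{d ≤ D} μ(d) w(d) log d → c`,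
`c := ∑_n b(n)/n`, and `𝔖(H' ∪ {hs}) = 𝔖(H') · c`.  Proof: `E_p` fails for `p > max (H' ∪ {hs})`
(there `ν_{H'∪{hs}}(p) = #H' + 1 > ν_{H'}(p)`), so `|b(p^k)| ≤ #H' + 1` always and `≤ 2#H'/(p-1)`
for large `p`; hence `∑_{n≤N} |b(n)|/√n ≤ S` (`exists_sum_abs_div_sqrt_le_of_local`), the limit is
`tendsto_neg_sum_moebius_log_weight`, and the identity is the Euler product `hasProd_one_add_div`
matched factorwise (`singularSeriesFactor_mul_eq`) with `hasProd_singularSeriesFactor_holds`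
(`HasProd.mul`, `HasProd.unique`). [folklore] -/
theorem stub_rungEuler : ∀ (H' : Finset ℕ) (hs : ℕ), hs ∉ H' → ∀ (G b : ArithmeticFunction ℝ), b.IsMultiplicative → (∀ d : ℕ, d ≠ 0 → G d = (ArithmeticFunction.moebius d : ℝ) * (d : ℝ) * (if ∀ h ∈ H', Nat.Coprime (d - hs % d + h) d then (((Finset.range d).filter (fun ρ : ℕ => ∀ h ∈ H', Nat.Coprime (ρ + h) d)).card : ℝ)⁻¹ else 0)) → b * (ArithmeticFunction.moebius : ArithmeticFunction ℝ) = G → (∀ p k : ℕ, p.Prime → 1 ≤ k → b (p ^ k) = 1 - (p : ℝ) * (if ∀ h ∈ H', Nat.Coprime (p - hs % p + h) p then (((Finset.range p).filter (fun ρ : ℕ => ∀ h ∈ H', Nat.Coprime (ρ + h) p)).card : ℝ)⁻¹ else 0)) → (∀ p : ℕ, p.Prime → (if ∀ h ∈ H', Nat.Coprime (p - hs % p + h) p then (((Finset.range p).filter (fun ρ : ℕ => ∀ h ∈ H', Nat.Coprime (ρ + h) p)).card : ℝ)⁻¹ else 0) = (if (∃ h ∈ H', p ∣ hs - h) then 0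 else ((p : ℝ) - Literature.NumberTheory.Sieve.tupleResidueCount ((H').image (fun h : ℕ => (h : ℤ))) p)⁻¹)) → (∀ p : ℕ, p.Prime → (Literature.NumberTheory.Sieve.tupleResidueCount ((insert hs H').image (fun h : ℕ => (h : ℤ))) p : ℝ) = Literature.NumberTheory.Sieve.tupleResidueCount ((H').image (fun h : ℕ => (h : ℤ))) p + (if (∃ h ∈ H', p ∣ hs - h) then 0 else 1)) → (∀ p : ℕ, p.Prime → ¬ (∃ h ∈ H', p ∣ hs - h) → Literature.NumberTheory.Sieve.tupleResidueCount ((H').image (fun h : ℕ => (h : ℤ))) p < p) → (∃ c : ℝ, Literature.NumberTheory.Sieve.singularSeries ((insert hs H').image (fun h : ℕ => (h : ℤ))) = Literature.NumberTheory.Sieve.singularSeries ((H').image (fun h : ℕ => (h : ℤ))) * c ∧ Filter.Tendsto (fun D : ℕ => -∑ d ∈ Finset.Icc 1 D, (ArithmeticFunction.moebius d : ℝ) * Real.log d * (if ∀ h ∈ H', Nat.Coprime (d - hs % d + h) d then (((Finset.range d).filter (fun ρ : ℕ => ∀ h ∈ H', Nat.Coprime (ρ + h) d)).card : ℝ)⁻¹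 else 0)) Filter.atTop (nhds c)) := by
  intro H' hs hnot G b hb hG hbG hbp hW hν hνlt
  set A : Finset ℤ := H'.image (fun h : ℕ => (h : ℤ)) with hA
  set B : Finset ℤ := (insert hs H').image (fun h : ℕ => (h : ℤ)) with hB
  have hcardA : A.card = H'.card := by
    rw [hA]; exact Finset.card_image_of_injective _ Nat.cast_injective
  have hcardB : B.card = H'.card + 1 := by
    rw [hB, Finset.card_image_of_injective _ Nat.cast_injective, Finset.card_insert_of_notMem hnot]
  have hνk : ∀ p : ℕ, (tupleResidueCount A p : ℝ) ≤ H'.card := fun p => by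
    exact_mod_cast (tupleResidueCount_le_card A p).trans_eq hcardA
  have hk0 : (0 : ℝ) ≤ H'.card := Nat.cast_nonneg _
  -- no prime beyond `M = max (insert hs H')` divides some `hs - h`
  set M : ℕ := (insert hs H').sup id with hM
  have hleM : ∀ x ∈ insert hs H', x ≤ M := fun x hx => Finset.le_sup (f := id) hx
  have hfar : ∀ p : ℕ, p.Prime → M < p → ¬ (∃ h ∈ H', p ∣ hs - h) := by
    intro p hp hMp hE
    have hBp : tupleResidueCount B p = H'.card + 1 := by
      rw [← hcardB]
      refine tupleResidueCount_eq_card_of_lt_holds B p ?_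
      intro a ha b hb
      rw [hB, Finset.mem_image] at ha hb
      obtain ⟨x, hx, rfl⟩ := ha
      obtain ⟨y, hy, rfl⟩ := hb
      have hx' := hleM x hx
      have hy' := hleM y hy
      rw [abs_sub_lt_iff]
      constructor <;> omega
    have hAp : tupleResidueCount A p ≤ H'.card := hcardA ▸ tupleResidueCount_le_card A p
    have h1 := hν p hp
    rw [if_pos hE, add_zero, hBp] at h1
    have h2 : H'.card + 1 = tupleResidueCount A p := by exact_mod_cast h1
    omega
  -- the local data `β_p = b(p^k) = 1 - p w(p)`
  obtain ⟨β, hβ⟩ : ∃ β : ℕ → ℝ, β = fun p : ℕ => 1 - (p : ℝ) *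
      (if (∃ h ∈ H', p ∣ hs - h) then 0 else ((p : ℝ) - tupleResidueCount A p)⁻¹) := ⟨_, rfl⟩
  have hbp' : ∀ p k : ℕ, p.Prime → 1 ≤ k → b (p ^ k) = β p := by
    intro p k hp hk
    rw [hbp p k hp hk, hW p hp, hβ]
  have hβE : ∀ p : ℕ, ¬ (∃ h ∈ H', p ∣ hs - h) → 0 < (p : ℝ) - tupleResidueCount A p →
      |β p| = (tupleResidueCount A p : ℝ) / ((p : ℝ) - tupleResidueCount A p) := by
    intro p hE hpn
    simp only [hβ, if_neg hE]
    rw [show (1 : ℝ) - p * ((p : ℝ) - tupleResidueCount A p)⁻¹ =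
        -((tupleResidueCount A p : ℝ) / ((p : ℝ) - tupleResidueCount A p)) by
      field_simp; ring, abs_neg, abs_of_nonneg (div_nonneg (Nat.cast_nonneg _) hpn.le)]
  have hβT : ∀ p : ℕ, p.Prime → |β p| ≤ (H'.card : ℝ) + 1 := by
    intro p hp
    by_cases hE : ∃ h ∈ H', p ∣ hs - h
    · simp only [hβ, if_pos hE, mul_zero, sub_zero, abs_one]
      linarith
    · have h1 : (tupleResidueCount A p : ℝ) + 1 ≤ p := by exact_mod_cast hνlt p hp hE
      have hpn : (0 : ℝ) < (p : ℝ) - tupleResidueCount A p := by linarith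
      rw [hβE p hE hpn, div_le_iff₀ hpn]
      nlinarith [hνk p, mul_nonneg (by linarith : (0 : ℝ) ≤ H'.card + 1)
        (by linarith : (0 : ℝ) ≤ (p : ℝ) - tupleResidueCount A p - 1)]
  have hβC : ∀ p : ℕ, p.Prime → M + 2 * H'.card < p →
      |β p| ≤ 2 * (H'.card : ℝ) / ((p : ℝ) - 1) := by
    intro p hp hMp
    have h2k : 2 * (H'.card : ℝ) < p := by exact_mod_cast (by omega : 2 * H'.card < p)
    have hp2 : (2 : ℝ) ≤ p := by exact_mod_cast hp.two_le
    have hν0 : (0 : ℝ) ≤ tupleResidueCount A p := Nat.cast_nonneg _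
    have hpn : (0 : ℝ) < (p : ℝ) - tupleResidueCount A p := by linarith [hνk p]
    rw [hβE p (hfar p hp (by omega)) hpn, div_le_div_iff₀ hpn (by linarith)]
    nlinarith [hνk p, mul_nonneg hk0 (sub_nonneg.mpr (hνk p)),
      mul_nonneg (by linarith : (0 : ℝ) ≤ p) (sub_nonneg.mpr (hνk p)),
      mul_nonneg hk0 (by linarith : (0 : ℝ) ≤ (p : ℝ) - 2 * H'.card)]
  -- the uniform bound, the Euler product and the factor identity
  obtain ⟨S, hS⟩ := exists_sum_abs_div_sqrt_le_of_local b hb β hbp' (M := M + 2 * H'.card)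
    (by positivity : (0 : ℝ) ≤ (H'.card : ℝ) + 1) (by positivity : (0 : ℝ) ≤ 2 * (H'.card : ℝ))
    hβT hβC
  have hEu := hasProd_one_add_div b hb β hbp' (summable_norm_div_of_bound b hS)
  have hSB : HasProd (fun p : Nat.Primes => singularSeriesFactor B p)
      (singularSeries A * ∑' n : ℕ, b n / n) := by
    have key : (fun p : Nat.Primes => singularSeriesFactor B p) =
        fun p : Nat.Primes => singularSeriesFactor A p * (1 + β p / (((p : ℕ) : ℝ) - 1)) := by
      funext p
      simp only [hβ]
      exact (singularSeriesFactor_mul_eq (by rw [hcardA, hcardB]) p.2 _ (hν p p.2)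
        (hνlt p p.2)).symm
    rw [key]
    exact (hasProd_singularSeriesFactor_holds A).mul hEu
  exact ⟨∑' n : ℕ, b n / n, (hasProd_singularSeriesFactor_holds B).unique hSB,
    tendsto_neg_sum_moebius_log_weight b G _ hG hbG hS⟩

end Summit.Parity.GeneralizedHardyLittlewood.Theorems.EngineToGHL.TupleLadder
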